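import Literature.Geometry.Riemannian.MeanConvexSurroundingProofs

/-!
# Lawson–Michelsohn (1984), Theorem 6.1 in `ℝ^{m+1}` — proof file, part 3: independence of the
# mean-convexity clause from the defining function

Topic `Geometry/Riemannian`; namespace `Literature.Geometry.Riemannian`. Continuation of
`MeanConvexSurroundingProofs.lean` (fact
`Literature.Geometry.Riemannian.LawsonMichelsohn1984_surrounding`).  Everything here is
**proved**; no statement is introduced.

The conclusion of the fact presents the surrounding hypersurface as the regular zero set of a
function `F'` and expresses `H > 0` as `0 < ∑ᵢ D²F'(x)(vᵢ, vᵢ)` over orthonormal frames of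
`ker dF'(x)`.  This clause does not depend on the choice of `F'`: if `F'' = g · F'` with `g > 0`,
then along `{F' = 0}` one has `dF'' = g dF'` and, on `ker dF'`, `D²F'' = g D²F'` (the cross
terms `dg ⊗ dF' + dF' ⊗ dg` vanish there and the term `F' D²g` vanishes on the zero set) —
Lawson–Michelsohn, §2, (2.4)–(2.6): the second fundamental form of a level hypersurface is
`Hess F/‖∇F‖` on tangent vectors, a quantity attached to the hypersurface and its normal
orientation only.  Contents (real normed space `E`, `f g : E → ℝ`):

* `fderiv_mul_of_eq_zero` — `d(g f)(x) = g(x) df(x)` at a zero of `f`;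
* `iteratedFDeriv_two_mul_of_eq_zero` — `D²(g f)(x)(u, v) = g(x) D²f(x)(u, v)` for
  `u, v ∈ ker df(x)` at a zero of `f` (`f`, `g` of class `C²` at `x`);
* `sum_iteratedFDeriv_two_mul_pos_iff` — hence positivity of the frame sums is the same for `f`
  and `g f` when `g(x) > 0`, and `setOf_mul_nonpos_eq`, `setOf_mul_eq_zero_eq`,
  `fderiv_mul_ne_zero_of_eq_zero`: `{g f ≤ 0} = {f ≤ 0}`, `{g f = 0} = {f = 0}`, regularity is
  kept, for `g > 0`.

## References

* H. B. Lawson, Jr., M.-L. Michelsohn, *Embedding and surrounding with positive mean curvature*,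
  Invent. Math. 77 (1984), 399–419, doi:10.1007/bf01388830: §2, (2.4)–(2.6).
  [LawsonMichelsohn1984]
-/

noncomputable section

open scoped ContDiff Topology
open Set

namespace Literature.Geometry.Riemannian

variable {E : Type*} [NormedAddCommGroup E] [NormedSpace ℝ E] {f g : E → ℝ} {x : E}

/-- At a zero of `f`, `d(g f)(x) = g(x) df(x)`. [folklore] -/
theorem fderiv_mul_of_eq_zero (hf : DifferentiableAt ℝ f x) (hg : DifferentiableAt ℝ g x)
    (hfx : f x = 0) : fderiv ℝ (fun y => g y * f y) x = g x • fderiv ℝ f x := by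
  rw [fderiv_fun_mul hg hf, hfx, zero_smul, add_zero]

/-- At a zero of `f`, `g f` is regular iff `f` is, when `g(x) ≠ 0`. [folklore] -/
theorem fderiv_mul_ne_zero_of_eq_zero (hf : DifferentiableAt ℝ f x) (hg : DifferentiableAt ℝ g x)
    (hfx : f x = 0) (hgx : g x ≠ 0) (hdf : fderiv ℝ f x ≠ 0) :
    fderiv ℝ (fun y => g y * f y) x ≠ 0 := by
  rw [fderiv_mul_of_eq_zero hf hg hfx]
  exact smul_ne_zero hgx hdf

/-- At a zero of `f`, `ker d(g f)(x) = ker df(x)` when `g(x) ≠ 0`. [folklore] -/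
theorem fderiv_mul_apply_eq_zero_iff (hf : DifferentiableAt ℝ f x) (hg : DifferentiableAt ℝ g x)
    (hfx : f x = 0) (hgx : g x ≠ 0) (u : E) :
    fderiv ℝ (fun y => g y * f y) x u = 0 ↔ fderiv ℝ f x u = 0 := by
  rw [fderiv_mul_of_eq_zero hf hg hfx, smul_apply, smul_eq_mul, mul_eq_zero]
  exact or_iff_right hgx

/-- **`D²(g f) = g D²f` on `ker df` along `{f = 0}`.**  For `f`, `g` of class `C²` at a zero `x`
of `f` and `u, v ∈ ker df(x)`: `D²(g f)(x)(u, v) = g(x) D²f(x)(u, v)`.  (Leibniz: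
`D²(g f) = g D²f + dg ⊗ df + df ⊗ dg + f D²g`; the middle terms vanish on `ker df(x)`, the last
at the zero.)  [folklore] -/
theorem iteratedFDeriv_two_mul_of_eq_zero (hf : ContDiffAt ℝ 2 f x) (hg : ContDiffAt ℝ 2 g x)
    (hfx : f x = 0) {u v : E} (hu : fderiv ℝ f x u = 0) (hv : fderiv ℝ f x v = 0) :
    iteratedFDeriv ℝ 2 (fun y => g y * f y) x ![u, v] = g x * iteratedFDeriv ℝ 2 f x ![u, v] := by
  rw [iteratedFDeriv_two_apply, iteratedFDeriv_two_apply]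
  simp only [Matrix.cons_val_zero, Matrix.cons_val_one]
  -- `f`, `g` are differentiable near `x`, and `df`, `dg` are differentiable at `x`
  have hf1 : ∀ᶠ y in 𝓝 x, DifferentiableAt ℝ f y :=
    (hf.eventually (by simp)).mono fun y hy => hy.differentiableAt (by simp)
  have hg1 : ∀ᶠ y in 𝓝 x, DifferentiableAt ℝ g y :=
    (hg.eventually (by simp)).mono fun y hy => hy.differentiableAt (by simp)
  have hdf : DifferentiableAt ℝ (fderiv ℝ f) x :=
    (hf.fderiv_right (m := 1) (by norm_num)).differentiableAt one_ne_zero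
  have hdg : DifferentiableAt ℝ (fderiv ℝ g) x :=
    (hg.fderiv_right (m := 1) (by norm_num)).differentiableAt one_ne_zero
  have hfd : DifferentiableAt ℝ f x := hf.differentiableAt (by simp)
  have hgd : DifferentiableAt ℝ g x := hg.differentiableAt (by simp)
  -- the first derivative near `x`
  have hev : fderiv ℝ (fun y => g y * f y) =ᶠ[𝓝 x]
      fun y => g y • fderiv ℝ f y + f y • fderiv ℝ g y := by
    filter_upwards [hf1, hg1] with y hfy hgy
    rw [fderiv_fun_mul hgy hfy]
  rw [Filter.EventuallyEq.fderiv_eq hev]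
  -- differentiate the two products at `x`
  have h1 : HasFDerivAt (fun y => g y • fderiv ℝ f y)
      (g x • fderiv ℝ (fderiv ℝ f) x + (fderiv ℝ g x).smulRight (fderiv ℝ f x)) x :=
    hgd.hasFDerivAt.smul hdf.hasFDerivAt
  have h2 : HasFDerivAt (fun y => f y • fderiv ℝ g y)
      (f x • fderiv ℝ (fderiv ℝ g) x + (fderiv ℝ f x).smulRight (fderiv ℝ g x)) x :=
    hfd.hasFDerivAt.smul hdg.hasFDerivAt
  rw [(h1.fun_add h2).fderiv]
  simp [hfx, hu, hv, ContinuousLinearMap.smulRight_apply]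

/-- **The frame sums of `g f` and `f` have the same sign** at a zero `x` of `f` where `g(x) > 0`:
for a family `v` of vectors of `ker df(x)`,
`∑ᵢ D²(g f)(x)(vᵢ, vᵢ) = g(x) ∑ᵢ D²f(x)(vᵢ, vᵢ)`. [folklore] -/
theorem sum_iteratedFDeriv_two_mul_of_eq_zero {ι : Type*} [Fintype ι] (hf : ContDiffAt ℝ 2 f x)
    (hg : ContDiffAt ℝ 2 g x) (hfx : f x = 0) {v : ι → E} (hv : ∀ i, fderiv ℝ f x (v i) = 0) :
    ∑ i, iteratedFDeriv ℝ 2 (fun y => g y * f y) x ![v i, v i]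
      = g x * ∑ i, iteratedFDeriv ℝ 2 f x ![v i, v i] := by
  rw [Finset.mul_sum]
  exact Finset.sum_congr rfl fun i _ =>
    iteratedFDeriv_two_mul_of_eq_zero hf hg hfx (hv i) (hv i)

/-- Positivity of the frame sum is the same for `g f` and `f` at a zero of `f` where `g > 0`.
[folklore] -/
theorem sum_iteratedFDeriv_two_mul_pos_iff {ι : Type*} [Fintype ι] (hf : ContDiffAt ℝ 2 f x)
    (hg : ContDiffAt ℝ 2 g x) (hfx : f x = 0) (hgx : 0 < g x) {v : ι → E}
    (hv : ∀ i, fderiv ℝ f x (v i) = 0) :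
    0 < ∑ i, iteratedFDeriv ℝ 2 (fun y => g y * f y) x ![v i, v i] ↔
      0 < ∑ i, iteratedFDeriv ℝ 2 f x ![v i, v i] := by
  rw [sum_iteratedFDeriv_two_mul_of_eq_zero hf hg hfx hv]
  exact mul_pos_iff_of_pos_left hgx

omit [NormedAddCommGroup E] [NormedSpace ℝ E] in
/-- For `g > 0` everywhere, `{g f ≤ 0} = {f ≤ 0}`. [folklore] -/
theorem setOf_mul_nonpos_eq (hg : ∀ y, 0 < g y) : {y | g y * f y ≤ 0} = {y | f y ≤ 0} := by
  ext y
  simp only [mem_setOf_eq]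
  exact ⟨fun h => not_lt.1 fun hb => (mul_pos (hg y) hb).not_ge h,
    fun h => mul_nonpos_of_nonneg_of_nonpos (hg y).le h⟩

omit [NormedAddCommGroup E] [NormedSpace ℝ E] in
/-- For `g > 0` everywhere, `{g f = 0} = {f = 0}`. [folklore] -/
theorem setOf_mul_eq_zero_eq (hg : ∀ y, 0 < g y) : {y | g y * f y = 0} = {y | f y = 0} := by
  ext y
  simp only [mem_setOf_eq, mul_eq_zero]
  exact or_iff_right (hg y).ne'

/-- **Changing the defining function.**  If `f` presents a compact regular domain with
mean-convex boundary in the sense of the conclusion of `LawsonMichelsohn1984_surrounding` and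
`g` is a smooth positive function, then `g f` presents the same domain, with the same zero set,
regular, and with positive frame sums. [folklore] -/
theorem presentation_mul {m : ℕ} {F' g : EuclideanSpace ℝ (Fin (m + 1)) → ℝ}
    (hF' : ContDiff ℝ ∞ F') (hg : ContDiff ℝ ∞ g) (hgpos : ∀ y, 0 < g y)
    (hcpt : IsCompact {y | F' y ≤ 0}) (hreg : ∀ y, F' y = 0 → fderiv ℝ F' y ≠ 0)
    (hpos : ∀ y, F' y = 0 → ∀ v : Fin m → EuclideanSpace ℝ (Fin (m + 1)), Orthonormal ℝ v →
      (∀ i, fderiv ℝ F' y (v i) = 0) → 0 < ∑ i, iteratedFDeriv ℝ 2 F' y ![v i, v i]) :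
    ContDiff ℝ ∞ (fun y => g y * F' y) ∧ IsCompact {y | g y * F' y ≤ 0} ∧
    (∀ y, g y * F' y = 0 → fderiv ℝ (fun y => g y * F' y) y ≠ 0) ∧
    {y | g y * F' y = 0} = {y | F' y = 0} ∧
    ∀ y, g y * F' y = 0 → ∀ v : Fin m → EuclideanSpace ℝ (Fin (m + 1)), Orthonormal ℝ v →
      (∀ i, fderiv ℝ (fun y => g y * F' y) y (v i) = 0) →
      0 < ∑ i, iteratedFDeriv ℝ 2 (fun y => g y * F' y) y ![v i, v i] := by
  have hzero : ∀ y, g y * F' y = 0 → F' y = 0 := fun y hy =>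
    (mul_eq_zero.1 hy).resolve_left (hgpos y).ne'
  have hdF : ∀ y, DifferentiableAt ℝ F' y := fun y => hF'.differentiable (by simp) y
  have hdg : ∀ y, DifferentiableAt ℝ g y := fun y => hg.differentiable (by simp) y
  refine ⟨hg.mul hF', by rwa [setOf_mul_nonpos_eq hgpos], fun y hy => ?_,
    setOf_mul_eq_zero_eq hgpos, fun y hy v hv hvker => ?_⟩
  · exact fderiv_mul_ne_zero_of_eq_zero (hdF y) (hdg y) (hzero y hy) (hgpos y).ne'
      (hreg y (hzero y hy))
  · have hy0 := hzero y hy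
    have hvker' : ∀ i, fderiv ℝ F' y (v i) = 0 := fun i =>
      (fderiv_mul_apply_eq_zero_iff (hdF y) (hdg y) hy0 (hgpos y).ne' (v i)).1 (hvker i)
    have h2 : (2 : ℕ∞ω) ≤ ∞ := WithTop.coe_le_coe.mpr le_top
    exact (sum_iteratedFDeriv_two_mul_pos_iff (hF'.contDiffAt.of_le h2)
      (hg.contDiffAt.of_le h2) hy0 (hgpos y) hvker').2 (hpos y hy0 v hv hvker')

end Literature.Geometry.Riemannian

end
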